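import Literature.AlgebraicGeometry.Shioda1982.ExceptionalQuadruplesComplete
import HarnessLib

/-!
# Shioda 1982 / Meyer–Neutsch 1981: no exceptional quadruple at the level `N = 594` — kernel sweep, part 18 of 27

Topic `Literature/AlgebraicGeometry/Shioda1982`; companion of `ExceptionalQuadruplesComplete.lean` (search `checkB`, soundness
`tabelleOneCompleteAt_of_chunks`, invariant form `exists_mem_reps_of_isExceptionalQuadruple`, statement `TabelleOneCompleteAt`; sources,
method and framing in its module docstring) and of the series `ExceptionalQuadruplesSweep*.lean` (together: every level `2 ≤ N ≤ 180`
that is not a row of Tabelle 1; `…SweepTwoHundredTwenty/…TwoHundredSixty/…ThreeHundredForty.lean`,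
`…SweepTwoHundredFiftyTwo/…ThreeHundredNinetySix/…FourHundredSixtyEight.lean`, `…SweepTwoHundred.lean`: the levels `220, 260, 340`, `252, 396, 468`
and `200` of the families `20p`, `36p`, `40p`; `…Sweep<Level>[Part<K>].lean` for the `{2,3,5,7}`-smooth residual levels
`189, 192, 210, 216, 224, 240, 270, 288, 300, 315, 320, 324, 336, 360, 378, 384, 405, 420, 432, 448` `480 … 630`, and the last three levels
`450, 594, 612` of `(180, 630]` outside the ranges of the tree's character-sum families). THEOREMS only (no definition, no named fact): the same kernel
search at the single level `N = 594`, which carries NO row of [MeyerNeutsch1981Fermatquadrupel, Tabelle 1] (computer-generated there,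
"alle Fermatquadrupel für N ≤ 614 ermittelt", §2 p. 53) and lies above the range `N ≤ 180` of Shioda's table p. 727 — by Aoki's
Theorem C ([Aoki1983], computer-assisted for `181 ≤ m ≤ 672`) there is no exceptional element at any level `> 180`; the files
`ExceptionalQuadruplesSweepFiveHundredNinetyFourPartOne.lean`, `ExceptionalQuadruplesSweepFiveHundredNinetyFourPartTwo.lean`, `ExceptionalQuadruplesSweepFiveHundredNinetyFourPartThree.lean`, `ExceptionalQuadruplesSweepFiveHundredNinetyFourPartFour.lean`, `ExceptionalQuadruplesSweepFiveHundredNinetyFourPartFive.lean`, `ExceptionalQuadruplesSweepFiveHundredNinetyFourPartSix.lean`, `ExceptionalQuadruplesSweepFiveHundredNinetyFourPartSeven.lean`, `ExceptionalQuadruplesSweepFiveHundredNinetyFourPartEight.lean`, `ExceptionalQuadruplesSweepFiveHundredNinetyFourPartNine.lean`, `ExceptionalQuadruplesSweepFiveHundredNinetyFourPartTen.lean`, `ExceptionalQuadruplesSweepFiveHundredNinetyFourPartEleven.lean`, `ExceptionalQuadruplesSweepFiveHundredNinetyFourPartTwelve.lean`, `ExceptionalQuadruplesSweepFiveHundredNinetyFourPartThirteen.lean`,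 `ExceptionalQuadruplesSweepFiveHundredNinetyFourPartFourteen.lean`, `ExceptionalQuadruplesSweepFiveHundredNinetyFourPartFifteen.lean`, `ExceptionalQuadruplesSweepFiveHundredNinetyFourPartSixteen.lean`, `ExceptionalQuadruplesSweepFiveHundredNinetyFourPartSeventeen.lean`, `ExceptionalQuadruplesSweepFiveHundredNinetyFourPartEighteen.lean`, `ExceptionalQuadruplesSweepFiveHundredNinetyFourPartNineteen.lean`, `ExceptionalQuadruplesSweepFiveHundredNinetyFourPartTwenty.lean`, `ExceptionalQuadruplesSweepFiveHundredNinetyFourPartTwentyOne.lean`, `ExceptionalQuadruplesSweepFiveHundredNinetyFourPartTwentyTwo.lean`, `ExceptionalQuadruplesSweepFiveHundredNinetyFourPartTwentyThree.lean`, `ExceptionalQuadruplesSweepFiveHundredNinetyFourPartTwentyFour.lean`, `ExceptionalQuadruplesSweepFiveHundredNinetyFourPartTwentyFive.lean`, `ExceptionalQuadruplesSweepFiveHundredNinetyFourPartTwentySix.lean`, `ExceptionalQuadruplesSweepFiveHundredNinetyFour.lean` make the instance `N = 594` a kernel statement. The search at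
`N = 594` visits 5865948 candidate triples (`φ(594) − 1 = 179` units each), too many for one elaboration of bounded wall time, so the
chunks of first entries are spread over 27 files: `ExceptionalQuadruplesSweepFiveHundredNinetyFourPartOne.lean` — first entries `0 ≤ a < 7` (207837 candidates);
`ExceptionalQuadruplesSweepFiveHundredNinetyFourPartTwo.lean` — first entries `7 ≤ a < 14` (212153 candidates);
`ExceptionalQuadruplesSweepFiveHundredNinetyFourPartThree.lean` — first entries `14 ≤ a < 21` (215840 candidates);
`ExceptionalQuadruplesSweepFiveHundredNinetyFourPartFour.lean` — first entries `21 ≤ a < 28` (218899 candidates);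
`ExceptionalQuadruplesSweepFiveHundredNinetyFourPartFive.lean` — first entries `28 ≤ a < 35` (221328 candidates);
`ExceptionalQuadruplesSweepFiveHundredNinetyFourPartSix.lean` — first entries `35 ≤ a < 42` (223129 candidates);
`ExceptionalQuadruplesSweepFiveHundredNinetyFourPartSeven.lean` — first entries `42 ≤ a < 48` (192210 candidates);
`ExceptionalQuadruplesSweepFiveHundredNinetyFourPartEight.lean` — first entries `48 ≤ a < 55` (224805 candidates);
`ExceptionalQuadruplesSweepFiveHundredNinetyFourPartNine.lean` — first entries `55 ≤ a < 62` (224809 candidates);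
`ExceptionalQuadruplesSweepFiveHundredNinetyFourPartTen.lean` — first entries `62 ≤ a < 69` (224184 candidates);
`ExceptionalQuadruplesSweepFiveHundredNinetyFourPartEleven.lean` — first entries `69 ≤ a < 76` (222931 candidates);
`ExceptionalQuadruplesSweepFiveHundredNinetyFourPartTwelve.lean` — first entries `76 ≤ a < 82` (189609 candidates);
`ExceptionalQuadruplesSweepFiveHundredNinetyFourPartThirteen.lean` — first entries `82 ≤ a < 89` (218934 candidates);
`ExceptionalQuadruplesSweepFiveHundredNinetyFourPartFourteen.lean` — first entries `89 ≤ a < 96` (215884 candidates);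
`ExceptionalQuadruplesSweepFiveHundredNinetyFourPartFifteen.lean` — first entries `96 ≤ a < 104` (242183 candidates);
`ExceptionalQuadruplesSweepFiveHundredNinetyFourPartSixteen.lean` — first entries `104 ≤ a < 111` (207230 candidates);
`ExceptionalQuadruplesSweepFiveHundredNinetyFourPartSeventeen.lean` — first entries `111 ≤ a < 119` (230643 candidates);
`ExceptionalQuadruplesSweepFiveHundredNinetyFourPartEighteen.lean` — first entries `119 ≤ a < 126` (195689 candidates);
`ExceptionalQuadruplesSweepFiveHundredNinetyFourPartNineteen.lean` — first entries `126 ≤ a < 134` (215803 candidates);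
`ExceptionalQuadruplesSweepFiveHundredNinetyFourPartTwenty.lean` — first entries `134 ≤ a < 143` (231658 candidates);
`ExceptionalQuadruplesSweepFiveHundredNinetyFourPartTwentyOne.lean` — first entries `143 ≤ a < 152` (218597 candidates);
`ExceptionalQuadruplesSweepFiveHundredNinetyFourPartTwentyTwo.lean` — first entries `152 ≤ a < 161` (204199 candidates);
`ExceptionalQuadruplesSweepFiveHundredNinetyFourPartTwentyThree.lean` — first entries `161 ≤ a < 172` (228075 candidates);
`ExceptionalQuadruplesSweepFiveHundredNinetyFourPartTwentyFour.lean` — first entries `172 ≤ a < 184` (219135 candidates);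
`ExceptionalQuadruplesSweepFiveHundredNinetyFourPartTwentyFive.lean` — first entries `184 ≤ a < 198` (212407 candidates);
`ExceptionalQuadruplesSweepFiveHundredNinetyFourPartTwentySix.lean` — first entries `198 ≤ a < 218` (218088 candidates);
`ExceptionalQuadruplesSweepFiveHundredNinetyFour.lean` — first entries `218 ≤ a < 594` (229689 candidates); the last one assembles
`completeAt_fiveHundredNinetyFour` (every sorted pair-free primitive Hodge 4-multiset mod `594` is standard) and `not_isExceptionalQuadruple_fiveHundredNinetyFour`.
WHY THIS LEVEL (cell `pub-hfermat`): `594 = 2·3³·11`: the tree's character-sum families cover the levels `K·p`, `p` a prime above a bound depending on `K`, for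
`K ∈ {2, 3, 4, 6, 8, 9, 10, 12, 18, 20, 24, 36, 40}` or `K` a power of `2` or of `3` (`PicardNumber<K>Prime.lean`, `PicardNumberTwoPowerPrime.lean`,
`PicardNumberThreePowPrime.lean`) and the prime-power levels (`PicardNumberPrimePower.lean`); writing `594 = K·p` with `p` prime forces
`K ∈ {54, 198, 297}`, none of them among those `K`. `decide +kernel` only (no `native_decide`).

HONEST FRAMING (cell `pub-hfermat`): explicit algebraic cycles for specific Hodge classes on Fermat/Delsarte varieties; residual open
instances listed; no claim on general Hodge. These classes are algebraic (Lefschetz (1,1)); certified here is only the emptiness of the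
exceptional list at this level.

## References
* [MeyerNeutsch1981Fermatquadrupel] W. Meyer, W. Neutsch, *Fermatquadrupel*, Math. Ann. 256 (1981) 51–62, §2 p. 53, Tabelle 1 p. 54 (no row 594).
* [Shioda1982PicardFermat] T. Shioda, J. Fac. Sci. Univ. Tokyo IA 28 (1982) 725–734, table p. 727 (levels `≤ 180`), Prop. 4 (Q′) p. 729.
* [Aoki1983] N. Aoki, Math. Ann. 266 (1983) 23–54, Thm. C.
-/

namespace Literature.AlgebraicGeometry.Shioda1982

open Literature.AlgebraicGeometry.HodgeTheory

set_option maxHeartbeats 0 in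
/-- **The search at `N = 594` passes on the first entries `119 ≤ a < 126`** (part 18 of 27: 7 chunks, 195689 candidate
triples): every visited sorted quadruple of representatives there fails the Hodge test or is standard (`checkB`; `reps 594 = []`).
[cite: MeyerNeutsch1981Fermatquadrupel, §2 p. 53 ("alle Fermatquadrupel für N ≤ 614 ermittelt") and Tabelle 1 p. 54 (no row 594)]
[cite: Aoki1983, Thm. C] -/
theorem checkB_fiveHundredNinetyFour_partEighteen :
    ∀ p ∈ ([(119, 1), (120, 1), (121, 1), (122, 1), (123, 1), (124, 1), (125, 1)] : List (ℕ × ℕ)), checkB 594 p.1 p.2 = true := by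
  intro p hp
  simp only [List.mem_cons, List.not_mem_nil, or_false] at hp
  rcases hp with rfl | rfl | rfl | rfl | rfl | rfl | rfl <;> decide +kernel

end Literature.AlgebraicGeometry.Shioda1982
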